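import Literature.Barriers.Parity.FordMaynardTypeIStarBelowMinusOneHolds
import HarnessLib

/-!
# Ford–Maynard, Theorem 2.1 (minimal Type II ⇒ nothing): reduction to Theorem 9.1

`Literature.Barriers.Parity.FordMaynardMinimalTypeII` (K. Ford, J. Maynard, *On the theory of prime
producing sieves*, arXiv:2407.14368, Theorem 2.1 / Theorem 1.3(i)) was reduced in
`FordMaynardPrimeSievesMinimalTypeII.lean` (`FordMaynardMinimalTypeII_of_typeIStar`) to the two
named facts

* (A) `FordMaynardPrimeFreeOfTypeIStar` — Ford–Maynard's Theorem 9.1 (incl. Theorems 6.3(a), 6.4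
  and Lemma 5.11), still a named fact;
* (B) `FordMaynardTypeIStarBelowMinusOne` — §9.2, now PROVED
  (`FordMaynardTypeIStarBelowMinusOne_holds`, `FordMaynardTypeIStarBelowMinusOneHolds.lean`).

This file records the resulting reduction of Theorem 2.1 to (A) alone. Everything here is PROVED.

## References

* K. Ford, J. Maynard, *On the theory of prime producing sieves*, arXiv:2407.14368v1 (2024),
  Theorem 2.1, §9 (proof of Theorem 1.3(i): "apply Theorem 9.1 to f, taking ν sufficiently small").
  [FordMaynard2024PrimeSieves]
-/

namespace Literature.Barriers.Parity

/-- **Theorem 2.1 of Ford–Maynard follows from their Theorem 9.1** (the named fact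
`FordMaynardPrimeFreeOfTypeIStar`), the §9.2 input being proved
(`FordMaynardTypeIStarBelowMinusOne_holds`).
[cite: FordMaynard2024PrimeSieves, §9 (proof of Theorem 1.3(i))] -/
theorem FordMaynardMinimalTypeII_of_primeFree (hA : FordMaynardPrimeFreeOfTypeIStar) :
    FordMaynardMinimalTypeII :=
  FordMaynardMinimalTypeII_of_typeIStar hA FordMaynardTypeIStarBelowMinusOne_holds

end Literature.Barriers.Parity
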